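import Summits.AtomisticToContinuum.HydrodynamicLimit.Theorems.InformationPercolationEngineChaosClosesEulerLocalEquilibriumFromDissipationG
import Summits.AtomisticToContinuum.HydrodynamicLimit.Theorems.InformationPercolationEngineChaosClosesEulerStressIsotropyF
import HarnessLib

/-!
# Pointwise local equilibrium from the empirical H-theorem (crux `ChaosClosesEuler`, stmt-AtomisticToContinuum-15141,
# line `empirical-h-theorem`, stub `stub_localEquilibriumFromDissipation`) — helper H: the data of the assembly

WHAT. The explicit data fed to the hypotheses of the statement and the elementary budgets:
* `rhoW ρ₁ ρv` — the piecewise-affine DENSITY WEIGHT `h_ρ ∈ [0, 1]`, `= 1` on `[ρ₁, ρv/2]`, `= 0` on `(−∞, ρ₁/2] ∪ [ρv, ∞)`,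
  continuous and `(2/ρ₁ + 2/ρv)`-Lipschitz (the weight of `WindowedEntropyBalance` / `PointwiseEntropicChaos`);
* `exists_contactBand` — the CONTACT VALUE `Y = (3/2π) f_ex′` lies in `[1/2, 3/2]` on a band `(0, η_Y]` (from the proved
  `HsEosLowDensity`: `f_ex = F` analytic near `0`, `F′(0) = 2π/3`, continuity of `F′`);
* `weight_facts` — hence `0 ≤ h_ρ(a) Y(σ³a) ≤ 3/2` everywhere and `≥ 1/2` on the band `ρ₁ ≤ a`, `σ³a ≤ σ³ρv/2` when
  `σ³ρv ≤ η_Y`;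
* `abs_maxwellMoment_le'` — `|∫ ψ M_{1,θ,u}| ≤ C_ψ` (landed `MaxwellianMoments`);
* `measure_le_of_cover'` — the union bound with a finite family of individually budgeted events; `geom_half_sum_le_one`;
* `budget_le'` — the tolerance bookkeeping of the assembly.

References: elementary. `HsEosLowDensity_holds` (stmt-0768, proved) is used, not assumed.
-/

noncomputable section

namespace Summit.AtomisticToContinuum.HydrodynamicLimit.Theorems.ChaosClosesEulerLocalEquilibriumFromDissipation

open scoped BigOperators Topology Classical MeasureTheory ENNReal InnerProductSpace
open Filter Set MeasureTheory Function
open Literature.MathematicalPhysics.KineticTheory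
open Literature.Analysis.FluidPDE
open Summit.AtomisticToContinuum.HydrodynamicLimit.Theses.InformationPercolationEngine (HsEosLowDensity_holds)
open Summit.AtomisticToContinuum.HydrodynamicLimit.Theorems.ChaosClosesEulerStressIsotropy (abs_maxwellMoment_le)
open Summit.AtomisticToContinuum.HydrodynamicLimit.Theorems.ChaosClosesEulerMaxwellianMoments (stub_maxwellianMoments)

/-! ## §1 The density weight -/

/-- **The density weight** `h_ρ(a) = max 0 (min 1 (min (2a/ρ₁ − 1) (2 − 2a/ρv)))`: plateau `1` on `[ρ₁, ρv/2]`, zero on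
`(−∞, ρ₁/2] ∪ [ρv, ∞)`, piecewise affine. [folklore] -/
def rhoW (ρ₁ ρv a : ℝ) : ℝ := max 0 (min 1 (min (2 * a / ρ₁ - 1) (2 - 2 * a / ρv)))

/-- `0 ≤ h_ρ ≤ 1`. [folklore] -/
theorem rhoW_nonneg_le (ρ₁ ρv a : ℝ) : 0 ≤ rhoW ρ₁ ρv a ∧ rhoW ρ₁ ρv a ≤ 1 :=
  ⟨le_max_left _ _, max_le zero_le_one (min_le_left _ _)⟩

/-- `|h_ρ| ≤ 1`. [folklore] -/
theorem abs_rhoW_le (ρ₁ ρv a : ℝ) : |rhoW ρ₁ ρv a| ≤ 1 := by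
  rw [abs_of_nonneg (rhoW_nonneg_le ρ₁ ρv a).1]; exact (rhoW_nonneg_le ρ₁ ρv a).2

/-- `h_ρ` is continuous. [folklore] -/
theorem continuous_rhoW (ρ₁ ρv : ℝ) : Continuous (rhoW ρ₁ ρv) := by unfold rhoW; fun_prop

/-- `h_ρ = 0` on `[ρv, ∞)` (`0 < ρv`). [folklore] -/
theorem rhoW_eq_zero_of_ge {ρ₁ ρv a : ℝ} (hρv : 0 < ρv) (ha : ρv ≤ a) : rhoW ρ₁ ρv a = 0 := by
  unfold rhoW
  have h2 : 2 - 2 * a / ρv ≤ 0 := by rw [sub_nonpos, le_div_iff₀ hρv]; linarith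
  exact max_eq_left ((min_le_right _ _).trans ((min_le_right _ _).trans h2))

/-- `h_ρ = 0` on `(−∞, ρ₁/2]` (`0 < ρ₁`). [folklore] -/
theorem rhoW_eq_zero_of_le {ρ₁ ρv a : ℝ} (hρ₁ : 0 < ρ₁) (ha : a ≤ ρ₁ / 2) : rhoW ρ₁ ρv a = 0 := by
  unfold rhoW
  have h2 : 2 * a / ρ₁ - 1 ≤ 0 := by rw [sub_nonpos, div_le_iff₀ hρ₁]; linarith
  exact max_eq_left ((min_le_right _ _).trans ((min_le_left _ _).trans h2))

/-- `h_ρ = 1` on `[ρ₁, ρv/2]` (`0 < ρ₁`, `0 < ρv`). [folklore] -/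
theorem rhoW_eq_one {ρ₁ ρv a : ℝ} (hρ₁ : 0 < ρ₁) (hρv : 0 < ρv) (h1 : ρ₁ ≤ a) (h2 : a ≤ ρv / 2) : rhoW ρ₁ ρv a = 1 := by
  unfold rhoW
  have ha : 1 ≤ 2 * a / ρ₁ - 1 := by rw [le_sub_iff_add_le, le_div_iff₀ hρ₁]; linarith
  have hb : 1 ≤ 2 - 2 * a / ρv := by rw [le_sub_comm, div_le_iff₀ hρv]; linarith
  rw [min_eq_left (le_min ha hb), max_eq_right zero_le_one]

/-- Where `h_ρ ≠ 0`: `ρ₁/2 < a < ρv` (`0 < ρ₁`, `0 < ρv`). [folklore] -/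
theorem band_of_rhoW_ne_zero {ρ₁ ρv a : ℝ} (hρ₁ : 0 < ρ₁) (hρv : 0 < ρv) (h : rhoW ρ₁ ρv a ≠ 0) :
    ρ₁ / 2 < a ∧ a < ρv :=
  ⟨lt_of_not_ge fun hle => h (rhoW_eq_zero_of_le hρ₁ hle), lt_of_not_ge fun hle => h (rhoW_eq_zero_of_ge hρv hle)⟩

/-- **`h_ρ` is `(2/ρ₁ + 2/ρv)`-Lipschitz** (`0 < ρ₁`, `0 < ρv`; max/min are `1`-Lipschitz). [folklore] -/
theorem abs_rhoW_sub_le {ρ₁ ρv : ℝ} (hρ₁ : 0 < ρ₁) (hρv : 0 < ρv) (a b : ℝ) :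
    |rhoW ρ₁ ρv a - rhoW ρ₁ ρv b| ≤ (2 / ρ₁ + 2 / ρv) * |a - b| := by
  unfold rhoW
  have h1 := abs_max_sub_max_le_max 0 (min 1 (min (2 * a / ρ₁ - 1) (2 - 2 * a / ρv))) 0
    (min 1 (min (2 * b / ρ₁ - 1) (2 - 2 * b / ρv)))
  rw [sub_self, abs_zero] at h1
  have h2 := abs_min_sub_min_le_max 1 (min (2 * a / ρ₁ - 1) (2 - 2 * a / ρv)) 1 (min (2 * b / ρ₁ - 1) (2 - 2 * b / ρv))
  rw [sub_self, abs_zero] at h2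
  have h3 := abs_min_sub_min_le_max (2 * a / ρ₁ - 1) (2 - 2 * a / ρv) (2 * b / ρ₁ - 1) (2 - 2 * b / ρv)
  have e1 : |2 * a / ρ₁ - 1 - (2 * b / ρ₁ - 1)| = 2 / ρ₁ * |a - b| := by
    rw [show 2 * a / ρ₁ - 1 - (2 * b / ρ₁ - 1) = 2 / ρ₁ * (a - b) by ring, abs_mul, abs_of_pos (by positivity)]
  have e2 : |2 - 2 * a / ρv - (2 - 2 * b / ρv)| = 2 / ρv * |a - b| := by
    rw [show 2 - 2 * a / ρv - (2 - 2 * b / ρv) = -(2 / ρv * (a - b)) by ring, abs_neg, abs_mul, abs_of_pos (by positivity)]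
  rw [e1, e2] at h3
  have hm0 : max 0 |min 1 (min (2 * a / ρ₁ - 1) (2 - 2 * a / ρv)) - min 1 (min (2 * b / ρ₁ - 1) (2 - 2 * b / ρv))| =
      |min 1 (min (2 * a / ρ₁ - 1) (2 - 2 * a / ρv)) - min 1 (min (2 * b / ρ₁ - 1) (2 - 2 * b / ρv))| :=
    max_eq_right (abs_nonneg _)
  have hm1 : max 0 |min (2 * a / ρ₁ - 1) (2 - 2 * a / ρv) - min (2 * b / ρ₁ - 1) (2 - 2 * b / ρv)| =
      |min (2 * a / ρ₁ - 1) (2 - 2 * a / ρv) - min (2 * b / ρ₁ - 1) (2 - 2 * b / ρv)| := max_eq_right (abs_nonneg _)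
  rw [hm0] at h1; rw [hm1] at h2
  have hab : 0 ≤ |a - b| := abs_nonneg _
  calc _ ≤ _ := h1
    _ ≤ _ := h2
    _ ≤ max (2 / ρ₁ * |a - b|) (2 / ρv * |a - b|) := h3
    _ ≤ 2 / ρ₁ * |a - b| + 2 / ρv * |a - b| := max_le (le_add_of_nonneg_right (by positivity)) (le_add_of_nonneg_left (by positivity))
    _ = (2 / ρ₁ + 2 / ρv) * |a - b| := by ring

/-! ## §2 The contact value near vacuum -/

/-- **The contact value `Y = (3/2π) f_ex′` lies in `[1/2, 3/2]` on a band `(0, η_Y]`** (`HsEosLowDensity`: `f_ex = F`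
near `0⁺` with `F` analytic, `F′(0) = 2π/3`; continuity of `F′`). [folklore] -/
theorem exists_contactBand : ∃ ηY : ℝ, 0 < ηY ∧ ∀ a : ℝ, 0 < a → a ≤ ηY →
    1 / 2 ≤ 3 / (2 * Real.pi) * deriv hsExcessFreeEnergy a ∧ 3 / (2 * Real.pi) * deriv hsExcessFreeEnergy a ≤ 3 / 2 := by
  obtain ⟨η₀, hη₀, F, hFa, hEq, -, hF1, -⟩ := HsEosLowDensity_holds
  have h0mem : (0 : ℝ) ∈ Set.Ioo (-η₀) η₀ := ⟨by linarith, hη₀⟩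
  have hcont : ContinuousAt (deriv F) 0 := (hFa.deriv 0 h0mem).continuousAt
  have hπ := Real.pi_pos
  obtain ⟨d, hd, hdist⟩ := Metric.continuousAt_iff.1 hcont (Real.pi / 3) (by positivity)
  refine ⟨min (η₀ / 2) (d / 2), lt_min (by positivity) (by positivity), fun a ha haY => ?_⟩
  have haη : a < η₀ := lt_of_le_of_lt (haY.trans (min_le_left _ _)) (by linarith)
  have had : dist a 0 < d := by
    rw [Real.dist_eq, sub_zero, abs_of_pos ha]; exact lt_of_le_of_lt (haY.trans (min_le_right _ _)) (by linarith)
  have h1 := hdist had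
  rw [hF1, Real.dist_eq] at h1
  have hderiv : deriv hsExcessFreeEnergy a = deriv F a := by
    have hnhds : hsExcessFreeEnergy =ᶠ[𝓝 a] F :=
      Filter.eventuallyEq_of_mem (isOpen_Ioo.mem_nhds ⟨ha, haη⟩) (hEq.mono Set.Ioo_subset_Ico_self)
    exact hnhds.deriv_eq
  rw [hderiv]
  obtain ⟨hlo, hhi⟩ := abs_lt.1 h1
  constructor
  · rw [div_mul_eq_mul_div, le_div_iff₀ (by positivity)]; nlinarith
  · rw [div_mul_eq_mul_div, div_le_iff₀ (by positivity)]; nlinarith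

/-- **The combined weight `h_ρ(a) Y(σ³a)`**: with `h_ρ = rhoW ρ₁ ρv`, `0 < ρ₁`, `0 < ρv`, `0 < σ` and `σ³ρv ≤ η_Y` (the
band of `exists_contactBand`): `0 ≤ h_ρ(a) Y(σ³a) ≤ 3/2` for all `a`, and `1/2 ≤ h_ρ(a) Y(σ³a)` for `ρ₁ ≤ a`,
`σ³a ≤ σ³ρv/2`. [folklore] -/
theorem weight_facts {ηY : ℝ} (hY : ∀ a : ℝ, 0 < a → a ≤ ηY →
      1 / 2 ≤ 3 / (2 * Real.pi) * deriv hsExcessFreeEnergy a ∧ 3 / (2 * Real.pi) * deriv hsExcessFreeEnergy a ≤ 3 / 2)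
    {ρ₁ ρv σ : ℝ} (hρ₁ : 0 < ρ₁) (hρv : 0 < ρv) (hσ : 0 < σ) (hband : σ ^ 3 * ρv ≤ ηY) :
    (∀ a, 0 ≤ rhoW ρ₁ ρv a * (3 / (2 * Real.pi) * deriv hsExcessFreeEnergy (σ ^ 3 * a))) ∧
    (∀ a, |rhoW ρ₁ ρv a * (3 / (2 * Real.pi) * deriv hsExcessFreeEnergy (σ ^ 3 * a))| ≤ 3 / 2) ∧
    (∀ a, ρ₁ ≤ a → σ ^ 3 * a ≤ σ ^ 3 * ρv / 2 →
      1 / 2 ≤ rhoW ρ₁ ρv a * (3 / (2 * Real.pi) * deriv hsExcessFreeEnergy (σ ^ 3 * a))) := by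
  have hσ3 : 0 < σ ^ 3 := pow_pos hσ 3
  have hin : ∀ a, rhoW ρ₁ ρv a ≠ 0 → 0 < σ ^ 3 * a ∧ σ ^ 3 * a ≤ ηY := fun a h => by
    obtain ⟨h1, h2⟩ := band_of_rhoW_ne_zero hρ₁ hρv h
    exact ⟨mul_pos hσ3 (by linarith), (mul_le_mul_of_nonneg_left h2.le hσ3.le).trans hband⟩
  refine ⟨fun a => ?_, fun a => ?_, fun a h1 h2 => ?_⟩
  · by_cases h : rhoW ρ₁ ρv a = 0
    · rw [h, zero_mul]
    · obtain ⟨hp, hq⟩ := hin a h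
      exact mul_nonneg (rhoW_nonneg_le _ _ _).1 (by linarith [(hY _ hp hq).1])
  · by_cases h : rhoW ρ₁ ρv a = 0
    · rw [h, zero_mul, abs_zero]; norm_num
    · obtain ⟨hp, hq⟩ := hin a h
      have hw := rhoW_nonneg_le ρ₁ ρv a
      rw [abs_mul, abs_of_nonneg hw.1, abs_of_nonneg (by linarith [(hY _ hp hq).1])]
      calc _ ≤ 1 * (3 / 2) := mul_le_mul hw.2 (hY _ hp hq).2 (by linarith [(hY _ hp hq).1]) zero_le_one
        _ = 3 / 2 := one_mul _
  · have ha2 : a ≤ ρv / 2 := le_of_mul_le_mul_left (by linarith [h2] : σ ^ 3 * a ≤ σ ^ 3 * (ρv / 2)) hσ3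
    rw [rhoW_eq_one hρ₁ hρv h1 ha2, one_mul]
    have hp : 0 < σ ^ 3 * a := mul_pos hσ3 (by linarith)
    have hq : σ ^ 3 * a ≤ ηY := by nlinarith [mul_pos hσ3 hρv]
    exact (hY _ hp hq).1

/-! ## §3 The Maxwellian moment, the union bound, the budgets -/

/-- **The Maxwellian moment of a bounded continuous test is bounded** (landed `MaxwellianMoments`). [folklore] -/
theorem abs_maxwellMoment_le' {ψ : V3 → ℝ} (hψc : Continuous ψ) {C : ℝ} (hψb : ∀ v, |ψ v| ≤ C) {θ : ℝ} (hθ : 0 < θ)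
    (u : V3) : |∫ v, ψ v * localMaxwellian 1 θ u v| ≤ C :=
  abs_maxwellMoment_le stub_maxwellianMoments hθ u hψc hψb

/-- **Union bound**: a null set, four bad events and a finite family of bad events cover the target event. [folklore] -/
theorem measure_le_of_cover' {Ω : Type*} [MeasurableSpace Ω] (P : Measure Ω) {Z S₁ S₂ S₃ S₄ D : Set Ω} {n : ℕ}
    {S : ℕ → Set Ω} (hZ : P Z = 0) {b₁ b₂ b₃ b₄ : ℝ≥0∞} {b : ℕ → ℝ≥0∞} (h₁ : P S₁ ≤ b₁) (h₂ : P S₂ ≤ b₂) (h₃ : P S₃ ≤ b₃)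
    (h₄ : P S₄ ≤ b₄) (hS : ∀ j ∈ Finset.range (n + 1), P (S j) ≤ b j)
    (hD : ∀ z, z ∉ Z → z ∉ S₁ → z ∉ S₂ → z ∉ S₃ → z ∉ S₄ → (∀ j ∈ Finset.range (n + 1), z ∉ S j) → z ∉ D) :
    P D ≤ b₁ + b₂ + b₃ + b₄ + ∑ j ∈ Finset.range (n + 1), b j := by
  have hsub : D ⊆ Z ∪ S₁ ∪ S₂ ∪ S₃ ∪ S₄ ∪ ⋃ j ∈ Finset.range (n + 1), S j := by
    intro z hz
    by_contra hcon
    simp only [Set.mem_union, Set.mem_iUnion, not_or, not_exists] at hcon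
    obtain ⟨⟨⟨⟨⟨n0, n1⟩, n2⟩, n3⟩, n4⟩, n5⟩ := hcon
    exact hD z n0 n1 n2 n3 n4 (fun j hj hzj => n5 j hj hzj) hz
  have hU : P (⋃ j ∈ Finset.range (n + 1), S j) ≤ ∑ j ∈ Finset.range (n + 1), b j :=
    (measure_biUnion_finset_le _ _).trans (Finset.sum_le_sum hS)
  calc P D ≤ P (Z ∪ S₁ ∪ S₂ ∪ S₃ ∪ S₄ ∪ ⋃ j ∈ Finset.range (n + 1), S j) := measure_mono hsub
    _ ≤ P (Z ∪ S₁ ∪ S₂ ∪ S₃ ∪ S₄) + P (⋃ j ∈ Finset.range (n + 1), S j) := measure_union_le _ _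
    _ ≤ P (Z ∪ S₁ ∪ S₂ ∪ S₃) + P S₄ + P (⋃ j ∈ Finset.range (n + 1), S j) := by gcongr; exact measure_union_le _ _
    _ ≤ P (Z ∪ S₁ ∪ S₂) + P S₃ + P S₄ + P (⋃ j ∈ Finset.range (n + 1), S j) := by gcongr; exact measure_union_le _ _
    _ ≤ P (Z ∪ S₁) + P S₂ + P S₃ + P S₄ + P (⋃ j ∈ Finset.range (n + 1), S j) := by gcongr; exact measure_union_le _ _
    _ ≤ P Z + P S₁ + P S₂ + P S₃ + P S₄ + P (⋃ j ∈ Finset.range (n + 1), S j) := by gcongr; exact measure_union_le _ _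
    _ ≤ 0 + b₁ + b₂ + b₃ + b₄ + ∑ j ∈ Finset.range (n + 1), b j := by gcongr; exact hZ.le
    _ = _ := by rw [zero_add]

/-- `Σ_{j < m} (1/2)^{j+1} ≤ 1`. [folklore] -/
theorem geom_half_sum_le_one (m : ℕ) : ∑ j ∈ Finset.range m, (1 / 2 : ℝ) ^ (j + 1) ≤ 1 := by
  have h : ∑ j ∈ Finset.range m, (1 / 2 : ℝ) ^ (j + 1) = 1 - (1 / 2 : ℝ) ^ m := by
    induction m with
    | zero => simp
    | succ k ih => rw [Finset.sum_range_succ, ih]; ring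
  rw [h]
  linarith [pow_nonneg (by norm_num : (0 : ℝ) ≤ 1 / 2) m]

/-- **The probability budget**: four events of probability `δ/8` and a finite family with `P_j ≤ δ (1/2)^{j+1}/4` cost at
most `δ`. [folklore] -/
theorem prob_budget_le {δ : ℝ} (hδ : 0 ≤ δ) (n : ℕ) :
    ENNReal.ofReal (δ / 8) + ENNReal.ofReal (δ / 8) + ENNReal.ofReal (δ / 8) + ENNReal.ofReal (δ / 8) +
      ∑ j ∈ Finset.range (n + 1), ENNReal.ofReal (δ * (1 / 2) ^ (j + 1) / 4) ≤ ENNReal.ofReal δ := by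
  have hj : ∀ j, 0 ≤ δ * (1 / 2 : ℝ) ^ (j + 1) / 4 := fun j => by positivity
  have h4 : ENNReal.ofReal (δ / 8) + ENNReal.ofReal (δ / 8) + ENNReal.ofReal (δ / 8) + ENNReal.ofReal (δ / 8) =
      ENNReal.ofReal (δ / 2) := by
    rw [← ENNReal.ofReal_add (by positivity : (0 : ℝ) ≤ δ / 8) (by positivity : (0 : ℝ) ≤ δ / 8),
      ← ENNReal.ofReal_add (by positivity : (0 : ℝ) ≤ δ / 8 + δ / 8) (by positivity : (0 : ℝ) ≤ δ / 8),
      ← ENNReal.ofReal_add (by positivity : (0 : ℝ) ≤ δ / 8 + δ / 8 + δ / 8) (by positivity : (0 : ℝ) ≤ δ / 8)]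
    congr 1; ring
  have hS : ∑ j ∈ Finset.range (n + 1), ENNReal.ofReal (δ * (1 / 2) ^ (j + 1) / 4) ≤ ENNReal.ofReal (δ / 4) := by
    rw [← ENNReal.ofReal_sum_of_nonneg (fun j _ => hj j)]
    refine ENNReal.ofReal_le_ofReal ?_
    have hs : ∑ j ∈ Finset.range (n + 1), δ * (1 / 2 : ℝ) ^ (j + 1) / 4 =
        δ / 4 * ∑ j ∈ Finset.range (n + 1), (1 / 2 : ℝ) ^ (j + 1) := by
      rw [Finset.mul_sum]; exact Finset.sum_congr rfl fun j _ => by ring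
    rw [hs]
    have hg := geom_half_sum_le_one (n + 1)
    have hδ4 : 0 ≤ δ / 4 := by positivity
    nlinarith
  calc _ = ENNReal.ofReal (δ / 2) + ∑ j ∈ Finset.range (n + 1), ENNReal.ofReal (δ * (1 / 2) ^ (j + 1) / 4) := by rw [h4]
    _ ≤ ENNReal.ofReal (δ / 2) + ENNReal.ofReal (δ / 4) := add_le_add le_rfl hS
    _ = ENNReal.ofReal (δ / 2 + δ / 4) := (ENNReal.ofReal_add (by positivity) (by positivity)).symm
    _ ≤ ENNReal.ofReal δ := ENNReal.ofReal_le_ofReal (by linarith)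

/-- **The tolerance budget of the assembly.** With `ε′ = η/(4(C_h t + 1))`, `η′ = η/(16(Q+1))`,
`ε_C = η/(16(Q+1)(C_m+1))`, `Q ω ≤ η/16` and the tail thresholds `κ_j = η (1/2)^{j+1}/(4(B₀+1)(j+1))`, the bound of the
deterministic core is `≤ η` (in fact `≤ 11η/16`). [folklore] -/
theorem budget_le' {η t Ch B₀ Q Cm ω : ℝ} (hη : 0 < η) (ht : 0 ≤ t) (hCh : 0 ≤ Ch) (hB₀ : 0 ≤ B₀) (hQ : 0 ≤ Q)
    (hCm : 0 ≤ Cm) (hω : Q * ω ≤ η / 16) (n : ℕ) :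
    Ch * (η / (4 * (Ch * t + 1))) * t +
      Q * (η / (16 * (Q + 1)) + Cm * (η / (16 * (Q + 1) * (Cm + 1))) + ω) +
      B₀ * ∑ j ∈ Finset.range (n + 1), ((j : ℝ) + 1) * (η * (1 / 2) ^ (j + 1) / (4 * (B₀ + 1) * ((j : ℝ) + 1))) ≤ η := by
  have T1 : Ch * (η / (4 * (Ch * t + 1))) * t ≤ η / 4 := by
    have h := ChaosClosesEulerStressIsotropy.mul_div_add_one_le (x := Ch * t) (c := η / 4) (by positivity) (by positivity)
    calc Ch * (η / (4 * (Ch * t + 1))) * t = Ch * t * (η / 4 / (Ch * t + 1)) := by rw [div_div]; ring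
      _ ≤ η / 4 := h
  have T2a : Q * (η / (16 * (Q + 1))) ≤ η / 16 := by
    have h := ChaosClosesEulerStressIsotropy.mul_div_add_one_le (x := Q) (c := η / 16) hQ (by positivity)
    calc Q * (η / (16 * (Q + 1))) = Q * (η / 16 / (Q + 1)) := by rw [div_div]
      _ ≤ η / 16 := h
  have T2b : Q * (Cm * (η / (16 * (Q + 1) * (Cm + 1)))) ≤ η / 16 := by
    have h1 := ChaosClosesEulerStressIsotropy.mul_div_add_one_le (x := Cm) (c := η / 16 / (Q + 1)) hCm (by positivity)
    have h2 := ChaosClosesEulerStressIsotropy.mul_div_add_one_le (x := Q) (c := η / 16) hQ (by positivity)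
    calc Q * (Cm * (η / (16 * (Q + 1) * (Cm + 1)))) = Q * (Cm * (η / 16 / (Q + 1) / (Cm + 1))) := by
          rw [div_div, div_div, mul_assoc]
      _ ≤ Q * (η / 16 / (Q + 1)) := mul_le_mul_of_nonneg_left h1 hQ
      _ ≤ η / 16 := h2
  have T3 : B₀ * ∑ j ∈ Finset.range (n + 1), ((j : ℝ) + 1) * (η * (1 / 2) ^ (j + 1) / (4 * (B₀ + 1) * ((j : ℝ) + 1))) ≤ η / 4 := by
    have hs : ∑ j ∈ Finset.range (n + 1), ((j : ℝ) + 1) * (η * (1 / 2) ^ (j + 1) / (4 * (B₀ + 1) * ((j : ℝ) + 1))) =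
        η / 4 / (B₀ + 1) * ∑ j ∈ Finset.range (n + 1), (1 / 2 : ℝ) ^ (j + 1) := by
      rw [Finset.mul_sum]
      refine Finset.sum_congr rfl fun j _ => ?_
      have hj : (j : ℝ) + 1 ≠ 0 := by positivity
      have hB1 : B₀ + 1 ≠ 0 := by positivity
      rw [div_mul_eq_mul_div, mul_div_assoc']
      exact (div_eq_div_iff (by positivity) (by positivity)).2 (by ring)
    rw [hs]
    have h := ChaosClosesEulerStressIsotropy.mul_div_add_one_le (x := B₀) (c := η / 4) hB₀ (by positivity)
    calc B₀ * (η / 4 / (B₀ + 1) * ∑ j ∈ Finset.range (n + 1), (1 / 2 : ℝ) ^ (j + 1))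
        ≤ B₀ * (η / 4 / (B₀ + 1) * 1) := mul_le_mul_of_nonneg_left
          (mul_le_mul_of_nonneg_left (geom_half_sum_le_one _) (by positivity)) hB₀
      _ = B₀ * (η / 4 / (B₀ + 1)) := by rw [mul_one]
      _ ≤ η / 4 := h
  have e2 : Q * (η / (16 * (Q + 1)) + Cm * (η / (16 * (Q + 1) * (Cm + 1))) + ω) =
      Q * (η / (16 * (Q + 1))) + Q * (Cm * (η / (16 * (Q + 1) * (Cm + 1)))) + Q * ω := by ring
  rw [e2]
  linarith

/-! ## §4 Registered sub-goal -/

/-- **Registered sub-goal `stub_localEquilibriumFromDissipationH` (helper H of `stub_localEquilibriumFromDissipation`):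
the geometric half-sum is at most one.** [folklore] -/
theorem stub_localEquilibriumFromDissipationH : ∀ (m : ℕ), ∑ j ∈ Finset.range m, (1 / 2 : ℝ) ^ (j + 1) ≤ 1 :=
  fun m => geom_half_sum_le_one m

end Summit.AtomisticToContinuum.HydrodynamicLimit.Theorems.ChaosClosesEulerLocalEquilibriumFromDissipation

end
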